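import Summits.NavierStokesRegularity.NavierStokesRegularity.Theorems.AdaptedFrequencyAdaptedKernelExistsPrekernelDecay
import Summits.NavierStokesRegularity.NavierStokesRegularity.Theorems.AdaptedFrequencyAdaptedKernelExistsPrekernelComparison
import Summits.NavierStokesRegularity.NavierStokesRegularity.Theorems.AdaptedFrequencyAdaptedKernelExistsPrekernelPositivity

/-!
# Crux `AdaptedKernelExists` (stmt-NavierStokesRegularity-2956), line `nash-entropy-last-block`:
  STUB `stub_prekernelBounds` (positivity and the upper comparison for the smooth representative)

This file (lands `--supports stmt-NavierStokesRegularity-2956`) proves the registered stub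
`stub_prekernelBounds` of the line's skeleton VERBATIM. Setting: `ν > 0`, `ta < Ta < T`, a drift
`b` jointly smooth on `Ico ta T × ℝ³` with `‖b‖ ≤ B`; an `L²` corrector `w` vanishing off the strip
`Ioo ta Ta × ℝ³`; `g` jointly smooth on the open slab `Ioo ta T × ℝ³`, a classical solution of
`∂ₜg + b·∇g + νΔg = 0` there, with `Γ + w = g` a.e. on the slab (`Γ = backwardHeatKernel ν T x₀`).
Claims: (i) `g(t, ·) = Γ(t, ·)` for `t ∈ Ico Ta T`; (ii) `g > 0` on the slab; (iii) for
`t ∈ Ioo ta Ta`, every `x` and `δ > 0` there is `σ₀ ∈ (0, ν(Ta − t)]` with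
`g(t, x) ≤ ∫ Γ(Ta, z) · driftKernel 1 (B/ν) (ν(Ta − t) + σ₀) (x − z) dz + δ`.

Assembly of the helper files:
* (i) is `prekernel_eq_above` (`…PrekernelBridge`);
* on every block `[t, Ta]`, `t ∈ (ta, Ta)`, the reversed rescaled `v(σ) = g(Ta − σ/ν)` is in the
  local drift–heat class (`prekernel_bridge`, restricted), and `g → 0` at spatial infinity
  uniformly on the block (`prekernel_decay`, `…PrekernelDecay`: Lieberman's local maximum
  principle and the `L²`-smallness of far boxes);
* (ii): `prekernel_nonneg_of_decay` then `prekernel_pos_of_nonneg` (`…PrekernelPositivity`) on the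
  blocks, with the bottom datum `g(Ta) = Γ(Ta) > 0`; above `Ta`, `g = Γ > 0`;
* (iii): `prekernel_comparison` (`…PrekernelComparison`) with the top slice `g(Ta) = Γ(Ta)`
  (nonnegative, continuous, integrable) and the decay.
-/

noncomputable section

open MeasureTheory Set Filter Topology Metric Function Real
open scoped Laplacian ContDiff
open Literature.Analysis.FluidPDE Literature.Analysis.UnboundedOperators

namespace Summit.NavierStokesRegularity.NavierStokesRegularity.Theorems.AdaptedKernelExists.NashEntropyLastBlock

/-- **Stub 4c of line `nash-entropy-last-block` — positivity and the upper comparison for the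
smooth representative.** Setting: `ν > 0`, `ta < Ta < T`, `b` jointly smooth on `Ico ta T × ℝ³`
with `‖b‖ ≤ B`; `w` measurable, `w ∈ L²(ℝ × ℝ³)`, `w = 0` off the strip `Ioo ta Ta ×ˢ univ`; `g`
jointly smooth on the open slab `Ioo ta T × ℝ³`, a classical solution of `∂ₜg + b·∇g + νΔg = 0`
there, with `Γ + w = g` a.e. on the slab, `Γ = backwardHeatKernel ν T x₀`. CLAIMS:
(i) `g(t, ·) = Γ(t, ·)` for `t ∈ Ico Ta T`; (ii) `g > 0` on the slab; (iii) for `t ∈ Ioo ta Ta`,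
every `x` and `δ > 0` there is `σ₀ ∈ (0, ν(Ta − t)]` with
`g(t, x) ≤ ∫ Γ(Ta, z) · driftKernel 1 (B/ν) (ν(Ta − t) + σ₀) (x − z) dz + δ`.
Proof: (i) a.e.-equal continuous functions agree on the open set `Ioo Ta T × ℝ³`, continuity at
`Ta`; decay at spatial infinity on every block `[t, Ta]` by Lieberman's local maximum principle
(`Lieberman1996_local_max_holds`) for the reversed rescaled `±g` and the `L²`-smallness of far
boxes; (ii) the comparison principle with the constant barrier `−ε` (nonnegativity) and the
Gaussian lower bound by the earlier local mass (strict positivity), `g(Ta) = Γ(Ta) > 0`;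
(iii) the comparison from above with the supersolution barrier `k₊ ⋆ (ψ Γ(Ta))`. Uses the drift
bound, smoothness and the equation; not `div b = 0`, no rate. -/
theorem stub_prekernelBounds :
    ∀ (ν ta Ta T B : ℝ) (b : ℝ → EuclideanSpace ℝ (Fin 3) → EuclideanSpace ℝ (Fin 3))
      (x₀ : EuclideanSpace ℝ (Fin 3)) (w : ℝ × EuclideanSpace ℝ (Fin 3) → ℝ)
      (g : ℝ → EuclideanSpace ℝ (Fin 3) → ℝ),
      0 < ν → ta < Ta → Ta < T →
      IsSmoothSpaceTimeOn (Ico ta T) b →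
      (∀ t ∈ Ico ta T, ∀ x, ‖b t x‖ ≤ B) →
      Measurable w → MemLp w 2 volume → (∀ p, p.1 ∉ Ioo ta Ta → w p = 0) →
      IsSmoothSpaceTimeOn (Ioo ta T) g →
      (∀ᵐ p : ℝ × EuclideanSpace ℝ (Fin 3), p ∈ Ioo ta T ×ˢ univ →
        backwardHeatKernel ν T x₀ p.1 p.2 + w p = g p.1 p.2) →
      (∀ t ∈ Ioo ta T, ∀ x,
        deriv (fun s => g s x) t + fderiv ℝ (g t) x (b t x) + ν * (Δ (g t)) x = 0) →
      (∀ t ∈ Ico Ta T, g t = backwardHeatKernel ν T x₀ t) ∧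
      (∀ t ∈ Ioo ta T, ∀ x, 0 < g t x) ∧
      (∀ t ∈ Ioo ta Ta, ∀ x, ∀ δ : ℝ, 0 < δ → ∃ σ₀ : ℝ, 0 < σ₀ ∧ σ₀ ≤ ν * (Ta - t) ∧
        g t x ≤ (∫ z, backwardHeatKernel ν T x₀ Ta z *
            driftKernel 1 (B / ν) (ν * (Ta - t) + σ₀) (x - z)) + δ) := by
  intro ν ta Ta T B b x₀ w g hν hta hTa hb hB _ hw2 hw0 hg hae heq
  -- (i) `g = Γ` above the strip, and the bottom datum `g(Ta) = Γ(Ta)`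
  have hI : ∀ t ∈ Ico Ta T, g t = backwardHeatKernel ν T x₀ t :=
    prekernel_eq_above hν hta hTa hw0 hg hae
  have hB0 : 0 ≤ B := (norm_nonneg _).trans (hB ta ⟨le_rfl, hta.trans hTa⟩ x₀)
  have hΓTa : g Ta = backwardHeatKernel ν T x₀ Ta := hI Ta ⟨le_rfl, hTa⟩
  have hσTa : 0 < ν * (T - Ta) := mul_pos hν (sub_pos.2 hTa)
  have hTa0 : ∀ z, 0 < g Ta z := fun z => by rw [hΓTa]; exact heatKernel_pos hσTa _
  have hTac : Continuous (g Ta) := (prekernel_contDiff_slice hg ⟨hta, hTa⟩).continuous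
  have hTai : Integrable (g Ta) := by
    rw [hΓTa]
    show Integrable fun x => heatKernel (ν * (T - Ta)) (x - x₀)
    exact (integrable_heatKernel_holds hσTa).comp_sub_right x₀
  -- the blocks `[t, Ta]`: local class for the reversed rescaled `g`, and the decay (K1)
  have hblock : ∀ t ∈ Ioo ta Ta,
      (∃ a : ℝ → EuclideanSpace ℝ (Fin 3) → EuclideanSpace ℝ (Fin 3),
        IsDriftHeatSolutionOn a (fun σ => g (Ta - σ / ν)) (B / ν) (Icc 0 (ν * (Ta - t))) univ) ∧
      (∀ δ : ℝ, 0 < δ → ∃ ρ₀ : ℝ, ∀ s ∈ Icc t Ta, ∀ y, ρ₀ ≤ ‖y - x₀‖ → |g s y| ≤ δ) := by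
    intro t ht
    obtain ⟨a, hv⟩ := prekernel_bridge (t₁ := Ta) hν hta hTa hb hB hg heq
    refine ⟨⟨a, hv.mono (fun σ hσ => ⟨hσ.1, ?_⟩) Subset.rfl⟩,
      fun δ hδ => prekernel_decay hν hTa ht hb hB hw2 hg hae heq hδ⟩
    exact hσ.2.trans_lt (mul_lt_mul_of_pos_left (by linarith [ht.1]) hν)
  -- (ii) nonnegativity on the blocks, then strict positivity
  have hnn : ∀ t ∈ Ioo ta Ta, ∀ s ∈ Icc t Ta, ∀ x, 0 ≤ g s x := by
    intro t ht
    obtain ⟨⟨a, hv⟩, hdec⟩ := hblock t ht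
    exact prekernel_nonneg_of_decay hν hv (fun z => (hTa0 z).le) fun δ hδ => by
      obtain ⟨ρ₀, hρ₀⟩ := hdec δ hδ
      exact ⟨ρ₀, fun s hs y hy => (abs_le.1 (hρ₀ s hs y hy)).1⟩
  have hpos : ∀ t ∈ Ioo ta T, ∀ x, 0 < g t x := by
    intro t ht x
    rcases lt_or_ge t Ta with h | h
    · obtain ⟨⟨a, hv⟩, -⟩ := hblock t ⟨ht.1, h⟩
      exact prekernel_pos_of_nonneg hν h (div_nonneg hB0 hν.le) hv (hnn t ⟨ht.1, h⟩) hTac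
        (hTa0 x₀) x
    · rw [hI t ⟨h, ht.2⟩]
      exact heatKernel_pos (mul_pos hν (sub_pos.2 ht.2)) _
  refine ⟨hI, hpos, ?_⟩
  -- (iii) the comparison from above on the block `[t, Ta]`
  intro t ht x δ hδ
  obtain ⟨hv, hdec⟩ := hblock t ht
  have hdec' : ∀ δ : ℝ, 0 < δ → ∃ ρ₀ : ℝ, ∀ s ∈ Icc t Ta, ∀ y, ρ₀ ≤ ‖y - x₀‖ → g s y ≤ δ :=
    fun δ hδ => by
      obtain ⟨ρ₀, hρ₀⟩ := hdec δ hδ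
      exact ⟨ρ₀, fun s hs y hy => (abs_le.1 (hρ₀ s hs y hy)).2⟩
  have h := prekernel_comparison hν ht.2 hB0 hv (fun z => (hTa0 z).le) hTac hTai hdec' x hδ
  rw [hΓTa] at h
  exact h

end Summit.NavierStokesRegularity.NavierStokesRegularity.Theorems.AdaptedKernelExists.NashEntropyLastBlock

end
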